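import Summits.HubbardSuperconductivity.HubbardLadder.PairGapCeiling
import HarnessLib

/-!
# PairGapCeilingAlong — the COMMENSURATE form of the energy-only R4⁻ route (pub-hubbard, HubbardLadder)

HONEST FRAMING: ladder R1–R4 with certified numbers; no claim on H/H₀. EDGES only; the
hypothesis is a certificate TYPE plus one `@[conjecture]` node that is NOT claimed and NOT proved;
no certificate of the consumed kind exists or is requested. Result line (iii) of the cell is
unchanged: no R3 instance has been run; no dichotomy is certified at any size.

`PairGapCeiling` types the energy-only route with a pair charge gap `Δ₂(L) ≥ w > 0` on EVERY large
even side `L`. The physically honest form of pair incompressibility of the period-8 filled-stripe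
state is COMMENSURATE: a gap only on the sides `L = d·j` the stripe fits (`d = 8` or `16`); for
other even `L` a frustrated stripe may or may not keep the pair gap — unknown. This file records
what the commensurate hypothesis still decides:

* `PairChargeGapCertAlong H N d` — ⟨`w > 0`, `j₀`, `w ≤ Δ₂(d·j)` for all `j ≥ j₀`⟩;
  `PairChargeGapCert.along` restricts an all-sides certificate to it.
* `liminf_dWaveOrderParamSq_le_zero_of_pairChargeGapCertAlong` — for `d` even and positive and ANY
  admissible ground-state sequence `ψ` of the pure model at `(8, 1/8)`: along `k = (d/2)·j` the
  `d`-wave order parameter `σ_d²(ψ; k) = p_d(2k; ψ_{2k}) ≤ C(8)/(w·(2k)²) → 0`, hence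
  `liminf_k σ_d²(ψ; k) ≤ 0`.
* `pureModelStripeCompetition_of_pairChargeGapCertAlong` — hence the catalogued conjecture
  `Literature.Barriers.HubbardSuperconductivity.PureModelStripeCompetition` (`¬` d-wave pair-field
  LRO of the pure model at `(8, 1/8)`, LRO being a `liminf` over ALL `k`), from the COMMENSURATE
  hypothesis alone; `PairIncompressibleAlongEightPureU8Eighth` is the `d = 8` node.

What it does NOT give: the cell target `NoDWaveOrderPureU8Eighth` (`Targets`), which asks
`σ_d²(ψ; k) → 0` along ALL `k`; a subsequence hypothesis yields only the subsequence conclusion.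
So: commensurate pair incompressibility ⇒ `PureModelStripeCompetition` but (as typed here) not H⁻.
[cite: TasakiWatanabe2021, Theorem (10) and the discussion after eq. (11)];
[cite: QinEtAl2020, §IV p. 11]; [cite: ZhengEtAl2017].
-/

noncomputable section

namespace Summit.HubbardSuperconductivity.HubbardLadder

open Matrix Finset Filter Literature.Probability.LatticeModels
open Literature.MathematicalPhysics.QuantumLattice
open Literature.Barriers.HubbardSuperconductivity (PureModelStripeCompetition)
open scoped ComplexOrder Topology

/-! ## 1. The commensurate certificate type -/

/-- **Pair charge gap certificate ALONG the sides `L = d·j`.** A positive `w` with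
`w ≤ Δ₂(d·j) = pairChargeGap H N (d·j)` for every `j ≥ j₀`. For the period-8 stripe regime of the
pure model at `δ = 1/8` the honest choice is `d = 8` (or `16`): only sides the stripe fits.
[cite: TasakiWatanabe2021, eq. (3) and the criterion after it]; [cite: ZhengEtAl2017] -/
structure PairChargeGapCertAlong (H : TorusHamiltonianFamily) (N : ℕ → ℕ) (d : ℕ) where
  /-- the uniform lower bound on the pair charge gap along `L = d·j` -/
  w : ℝ
  w_pos : 0 < w
  /-- threshold multiplier index -/
  j₀ : ℕ
  bound : ∀ j, j₀ ≤ j → w ≤ pairChargeGap H N (d * j)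

namespace PairChargeGapCert

/-- An all-even-sides certificate restricts to the sides `d·j` for any even `d > 0`. -/
def along {H : TorusHamiltonianFamily} {N : ℕ → ℕ} (c : PairChargeGapCert H N) {d : ℕ}
    (hd : 0 < d) (hde : Even d) : PairChargeGapCertAlong H N d where
  w := c.w
  w_pos := c.w_pos
  j₀ := c.L₀
  bound j hj := c.bound (d * j) (le_trans hj (Nat.le_mul_of_pos_left j hd)) (hde.mul_right j)

end PairChargeGapCert

/-- **Commensurate pair incompressibility of the pure model at `(U, δ) = (8, 1/8)`** — a pair
charge gap bounded below uniformly on the sides `L ∈ 8ℕ` (large). OPEN; typed hypothesis, not a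
claim. Weaker than `PairIncompressiblePureU8Eighth` (all even sides). Evidence for: the consensus
period-8 filled (insulating) stripe without coexisting `d`-wave order at these parameters; against:
partially filled / weakly superconducting stripes within `≈ 0.01 t` per site.
[cite: ZhengEtAl2017]; [cite: QinEtAl2020, §IV p. 11]; [cite: TocchioMontorsiBecca2019] -/
@[conjecture] def PairIncompressibleAlongEightPureU8Eighth : Prop :=
  Nonempty (PairChargeGapCertAlong (pureHubbard 8) (electronNumber (1 / 8)) 8)

/-- The all-sides node implies the commensurate one. -/
theorem pairIncompressibleAlongEight_of_pairIncompressible (h : PairIncompressiblePureU8Eighth) :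
    PairIncompressibleAlongEightPureU8Eighth := by
  obtain ⟨c⟩ := h
  exact ⟨c.along (by norm_num) ⟨4, rfl⟩⟩

/-! ## 2. A commensurate gap kills the `liminf` of the order parameter -/

/-- **Commensurate pair charge gap ⇒ `liminf_k σ_d²(ψ; k) ≤ 0`** for every admissible ground-state
sequence of the pure model at `(8, 1/8)`: along `k = (d/2)·j`, `0 ≤ σ_d²(ψ; k) = p_d(2k) ≤
C(8)/(w (2k)²) → 0` (`pairChargeGap_mul_pairFieldDensity_le` and the certificate), so the order
parameter is frequently below every `ε > 0`.
[cite: TasakiWatanabe2021, Theorem (10) and the discussion after eq. (11)] -/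
theorem liminf_dWaveOrderParamSq_le_zero_of_pairChargeGapCertAlong {d : ℕ} (hd : 0 < d)
    (hde : Even d) (c : PairChargeGapCertAlong (pureHubbard 8) (electronNumber (1 / 8)) d)
    (ψ : ∀ L, Fock (Orb (FermionTorus 2 L)))
    (hψ : ∀ L, Even L → star (ψ L) ⬝ᵥ ψ L = 1 ∧
      IsGroundStateInSector (pureHubbard 8 L) (electronNumber (1 / 8) L) 0 (ψ L)) :
    liminf (fun k => dWaveOrderParamSq ψ k) atTop ≤ 0 := by
  obtain ⟨e, he⟩ := hde
  have he0 : 0 < e := by omega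
  obtain ⟨C, hC0, hC⟩ :=
    pairChargeGap_mul_pairFieldDensity_le 8 (δ := 1 / 8) (by norm_num) (by norm_num)
  have h2 : ∀ j, 2 * (e * j) = d * j := by intro j; rw [he]; ring
  have hej : ∀ j, j ≤ e * j := fun j => Nat.le_mul_of_pos_left j he0
  -- the subsequence `j ↦ k = e·j`, `L = 2k = d·j`
  have hcast : Tendsto (fun j : ℕ => (((2 * (e * j) : ℕ) : ℝ))) atTop atTop := by
    refine tendsto_natCast_atTop_atTop.comp ?_
    refine tendsto_atTop_mono (fun j => ?_) tendsto_id
    exact le_trans (hej j) (Nat.le_mul_of_pos_left _ (by norm_num))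
  have hden : Tendsto (fun j : ℕ => c.w * (((2 * (e * j) : ℕ) : ℝ)) ^ 2) atTop atTop :=
    ((tendsto_pow_atTop two_ne_zero).comp hcast).const_mul_atTop c.w_pos
  have hlim : Tendsto (fun j : ℕ => C / (c.w * (((2 * (e * j) : ℕ) : ℝ)) ^ 2)) atTop (𝓝 0) :=
    tendsto_const_nhds.div_atTop hden
  have hsub : Tendsto (fun j : ℕ => dWaveOrderParamSq ψ (e * j)) atTop (𝓝 0) := by
    refine squeeze_zero' ?_ ?_ hlim
    · filter_upwards [eventually_ge_atTop 1] with j hj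
      rw [dWaveOrderParamSq_eq_pairFieldDensity ψ (le_trans hj (hej j))]
      exact pairFieldDensity_nonneg _ _
    · filter_upwards [eventually_ge_atTop (max c.j₀ 2)] with j hj
      have hj0 : c.j₀ ≤ j := le_trans (le_max_left _ _) hj
      have hj2 : 2 ≤ j := le_trans (le_max_right _ _) hj
      have hk : 1 ≤ e * j := le_trans (by omega) (hej j)
      have hL4 : 4 ≤ 2 * (e * j) := by have := le_trans hj2 (hej j); omega
      rw [dWaveOrderParamSq_eq_pairFieldDensity ψ hk]
      have key := hC (2 * (e * j)) hL4 (ψ (2 * (e * j))) (hψ _ (even_two_mul _)).1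
        (hψ _ (even_two_mul _)).2
      have hw : c.w ≤ pairChargeGap (pureHubbard 8) (electronNumber (1 / 8)) (2 * (e * j)) := by
        rw [h2]; exact c.bound j hj0
      have hp0 : 0 ≤ pairFieldDensity (2 * (e * j)) (ψ (2 * (e * j))) := pairFieldDensity_nonneg _ _
      have hL0 : 0 < (((2 * (e * j) : ℕ) : ℝ)) ^ 2 := by positivity
      rw [le_div_iff₀ (mul_pos c.w_pos hL0)]
      calc pairFieldDensity (2 * (e * j)) (ψ (2 * (e * j))) * (c.w * (((2 * (e * j) : ℕ) : ℝ)) ^ 2)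
          = (c.w * pairFieldDensity (2 * (e * j)) (ψ (2 * (e * j)))) *
              (((2 * (e * j) : ℕ) : ℝ)) ^ 2 := by ring
        _ ≤ (pairChargeGap (pureHubbard 8) (electronNumber (1 / 8)) (2 * (e * j)) *
              pairFieldDensity (2 * (e * j)) (ψ (2 * (e * j)))) * (((2 * (e * j) : ℕ) : ℝ)) ^ 2 :=
            mul_le_mul_of_nonneg_right (mul_le_mul_of_nonneg_right hw hp0) hL0.le
        _ ≤ C := by rwa [← le_div_iff₀ hL0]
  -- bounded below (eventually nonnegative) and frequently `≤ ε` along the full sequence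
  have hbdd : IsBoundedUnder (· ≥ ·) atTop (fun k => dWaveOrderParamSq ψ k) := by
    refine ⟨0, eventually_map.2 (eventually_atTop.2 ⟨1, fun k hk => ?_⟩)⟩
    show 0 ≤ dWaveOrderParamSq ψ k
    rw [dWaveOrderParamSq_eq_pairFieldDensity ψ hk]
    exact pairFieldDensity_nonneg _ _
  refine le_of_forall_gt_imp_ge_of_dense fun ε hε => ?_
  have hev : ∀ᶠ j in atTop, dWaveOrderParamSq ψ (e * j) ≤ ε :=
    hsub.eventually (eventually_le_nhds hε)
  obtain ⟨j₁, hj₁⟩ := eventually_atTop.1 hev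
  have hfreq : ∃ᶠ k in atTop, dWaveOrderParamSq ψ k ≤ ε :=
    frequently_atTop.2 fun n =>
      ⟨e * max n j₁, le_trans (le_max_left _ _) (hej _), hj₁ _ (le_max_right _ _)⟩
  exact liminf_le_of_frequently_le hfreq hbdd

/-! ## 3. Edges to the catalogued conjecture -/

/-- **Commensurate pair incompressibility ⇒ `PureModelStripeCompetition`.** LRO is a positive
`liminf` over all `k`; §2 makes that `liminf` nonpositive for the admissible ground-state sequence
`exists_groundStateSeq_pure` supplies. [cite: QinEtAl2020, §IV p. 11];
[cite: TasakiWatanabe2021, discussion after eq. (11)] -/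
theorem pureModelStripeCompetition_of_pairChargeGapCertAlong {d : ℕ} (hd : 0 < d) (hde : Even d)
    (c : PairChargeGapCertAlong (pureHubbard 8) (electronNumber (1 / 8)) d) :
    PureModelStripeCompetition := by
  intro hAt
  obtain ⟨ψ, hψ⟩ := exists_groundStateSeq_pure 8 (1 / 8) (by norm_num)
  have hL : 0 < liminf (fun k => dWaveOrderParamSq ψ k) atTop :=
    hAt (electronNumber (1 / 8)) ψ fun L hL => ⟨rfl, hψ L hL⟩
  exact absurd hL (not_lt.2
    (liminf_dWaveOrderParamSq_le_zero_of_pairChargeGapCertAlong hd hde c ψ hψ))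

/-- **`PairIncompressibleAlongEightPureU8Eighth ⇒ PureModelStripeCompetition`.**
[cite: QinEtAl2020, §IV p. 11] -/
theorem pureModelStripeCompetition_of_pairIncompressibleAlongEight
    (h : PairIncompressibleAlongEightPureU8Eighth) : PureModelStripeCompetition := by
  obtain ⟨c⟩ := h
  exact pureModelStripeCompetition_of_pairChargeGapCertAlong (by norm_num) ⟨4, rfl⟩ c

end Summit.HubbardSuperconductivity.HubbardLadder
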